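import Mathlib
import HarnessLib
import Summits.HubbardSuperconductivity.HubbardSuperconductivity.Theorems.KLProgrammeKLRegimeFatFrameInstance

/-!
# Route `KLProgramme` — crux K3 ENGINE (stmt-…-20437) stub (b) conj. 2 «(c-D)² FAMILY TELESCOPE», brick (D2b-rest, part 1): the fat INCREMENT pair
# of `bgmFatMultiplier` across two frames IS a sampled increment-pair symbol — the `hGsΦ` of `…FatMultiplierIncrementPairSpace/Time`

Cell `gate-hubbard-kl`, seat hubbard-kl-k3c3-p2 (g10); (R68c); F1-DESIGN.md §7 (i).  The family defect of the two-defect split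
(`…SectorSliceFamilyDefectRows`) is a sum of products `F′_ωF′_ω′ − F_ωF_ω′ = (F′_ω − F_ω)F_ω′ + F′_ω(F′_ω′ − F_ω′)` of fat multipliers on two
frames `K′ = K_o` ("other") and `K = K_b` ("base").  With `bgmFat_apply` (radial factor `G_m(ω² + e_K²)`, angular factor frame-independent):

* `bgmFat_mul_bgmFat_eq_symbol₂` — the MIXED pair `F̃^{K_o}_{ω₁}·F̃^{K}_{ω₂}` is the sample of `G_m(k₀² + e_{K_o}²)·G_m(k₀² + e_K²)·Z_fat`
  (only the base frame's shell hypothesis is needed: where `R(½) ≠ 1` the base factor vanishes);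
* `bgmFat_mul_bgmFat_comm_frames` — `F̃^{K_o}_{ω₁}F̃^{K}_{ω₂} = F̃^{K}_{ω₁}F̃^{K_o}_{ω₂}` pointwise (radial factors commute);
* **`bgmFatIncr_mul_bgmFat_eq_symbol`** — `F̃^{K_o}_{ω₁}F̃^{K}_{ω₂} − F̃^{K}_{ω₁}F̃^{K}_{ω₂}` is the sample of the increment-pair symbol
  `Φ^Δ = (G_m(k₀² + (e_K − ν)²) − G_m(k₀² + e_K²))·(G_m(k₀² + e_K²)·Z_fat)`, `ν = e_K − e_{K_o}` — LITERALLY the `hΦ`/`hGsΦ` shape of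
  `norm_fwdDiff_iter_space_fatIncrPair_le` / `norm_fwdDiff_iter_time_fatIncrPair_le` (the second term of the split is the same lemma with the
  roles of the frames exchanged, by `bgmFat_mul_bgmFat_comm_frames`).

Everything is proved; no definitions, no sorry.  Nothing asserts superconductivity. [cite: BenfattoGiulianiMastropietro2006, §2.7 (2.66)]
-/

noncomputable section

namespace Summit.HubbardSuperconductivity.HubbardSuperconductivity.Theorems.TorusFourierL2

set_option linter.dupNamespace false -- summit = problem name (single-conjunct summit), D-0017

open Set Finset Literature.MathematicalPhysics.QuantumLattice Literature.MathematicalPhysics.QuantumLattice.BandSectorCounting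
open Literature.MathematicalPhysics.QuantumLattice.FermiRG Literature.Probability.LatticeModels Literature.Analysis.SpecialFunctions
open Summit.HubbardSuperconductivity.HubbardSuperconductivity.Theorems.DispersionFlow
open Summit.HubbardSuperconductivity.HubbardSuperconductivity.Theorems.KLRegimeSplit
open Summit.HubbardSuperconductivity.HubbardSuperconductivity.Theorems.KLProgrammeLegKernels
open Summit.HubbardSuperconductivity.HubbardSuperconductivity.Theorems.PerturbedFermiCurve
open scoped Real Nat

section IncrIdent

open Classical

variable {L M : ℕ} [NeZero L] [NeZero M] {K : TrigPolyC4v} (Ko : TrigPolyC4v) {A : ℝ}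
  (hA : ∀ p : Momentum, ∀ j ≤ 2, ‖iteratedFDeriv ℝ j (frameShift K) p‖ ≤ A)
  {μ e₀ z β : ℝ} (he : 0 < e₀) (hz : 0 < z) (h3 : e₀ + A - μ ≤ 3)
  (m : ℕ) (ω₁ ω₂ : Fin (sectorCount (m + 1)))
  {Z : (Fin 2 → ℝ) → ℝ}
  (hZ : ∀ p, Z p = gnCutoff ((π + z) ^ 2 / π ^ 2) ((π + z) ^ 2) (p 0 ^ 2) * gnCutoff ((π + z) ^ 2 / π ^ 2) ((π + z) ^ 2) (p 1 ^ 2) *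
    ((radialCutoffC (1 / 2) (momToComplex p) *
        ∑ a' ∈ (range (sectorCount (m + 1))).filter
          (fun ω' : ℕ => ∃ δ : ℤ, |δ| ≤ 1 ∧ (sectorCount (m + 1) : ℤ) ∣ ((ω' : ℤ) - ((ω₁ : ℕ) : ℤ) - δ)),
          sectorWeightCirc (m + 1) ((a' : ℕ) : ℤ) (polarAngle p)) *
      (radialCutoffC (1 / 2) (momToComplex p) *
        ∑ b' ∈ (range (sectorCount (m + 1))).filter
          (fun ω' : ℕ => ∃ δ : ℤ, |δ| ≤ 1 ∧ (sectorCount (m + 1) : ℤ) ∣ ((ω' : ℤ) - ((ω₂ : ℕ) : ℤ) - δ)),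
          sectorWeightCirc (m + 1) ((b' : ℕ) : ℤ) (polarAngle p))))

include hA h3 he hz hZ in
/-- **The mixed fat pair IS the sample of the two-frame symbol**: for every product-torus label `q`,
`F̃^{K_o}_{ω₁}(k(q))·F̃^{K}_{ω₂}(k(q)) = Φ₂(sample point)`, `Φ₂ = G_m(k₀² + e_{K_o}²)·G_m(k₀² + e_K²)·Z_fat`; only the base frame `K` needs the
shell hypothesis `e₀ + A − μ ≤ 3`. [cite: BenfattoGiulianiMastropietro2006, §2.7 (2.66)] -/
theorem bgmFat_mul_bgmFat_eq_symbol₂ {Φ₂ : ℝ × (Fin 2 → ℝ) → ℂ}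
    (hΦ₂ : ∀ k₀ p, Φ₂ (k₀, p) = ((bgmCutoffSq e₀ ((16 : ℝ) ^ m * (k₀ ^ 2 + frameLevel μ Ko (WithLp.toLp 2 p) ^ 2)) *
      bgmCutoffSq e₀ ((16 : ℝ) ^ m * (k₀ ^ 2 + frameLevel μ K (WithLp.toLp 2 p) ^ 2)) * Z p : ℝ) : ℂ))
    (q : TorusSite 1 (2 * M) × TorusSite 2 L) :
    bgmFatMultiplier L M e₀ β (nambuXiCT L μ Ko) (m + 1) ω₁ (⟨(q.1 0).val, ZMod.val_lt (q.1 0)⟩, q.2) *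
        bgmFatMultiplier L M e₀ β (nambuXiCT L μ K) (m + 1) ω₂ (⟨(q.1 0).val, ZMod.val_lt (q.1 0)⟩, q.2) =
      Φ₂ (π * (1 - 2 * M) / β + 2 * π / β * (((q.1 0).val : ℕ) : ℝ), fun j => 2 * π / L * (((q.2 j).valMinAbs : ℤ) : ℝ)) := by
  have hsp := sampledPoint_eq (L := L) (M := M) β q
  rw [← hsp, hΦ₂, bgmFat_apply (μ := μ) (e₀ := e₀) (β := β) (K := Ko) m ω₁, bgmFat_apply (μ := μ) (e₀ := e₀) (β := β) (K := K) m ω₂,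
    ← Complex.ofReal_mul]
  set k₀ : ℝ := matsubaraFreq β M (⟨(q.1 0).val, ZMod.val_lt (q.1 0)⟩ : MatsubaraIdx M) with hk₀
  set c : Fin 2 → ℝ := torusCentredMomentum L q.2 with hc
  have he_eq : nambuXiCT L μ K q.2 = frameLevel μ K (WithLp.toLp 2 c) :=
    Summit.HubbardSuperconductivity.HubbardSuperconductivity.Theorems.PerturbedFermiCurve.nambuXiCT_eq_frameLevel L μ K q.2
  have heo_eq : nambuXiCT L μ Ko q.2 = frameLevel μ Ko (WithLp.toLp 2 c) :=
    Summit.HubbardSuperconductivity.HubbardSuperconductivity.Theorems.PerturbedFermiCurve.nambuXiCT_eq_frameLevel L μ Ko q.2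
  have hang : momentumAngle L q.2 = polarAngle c := rfl
  rw [he_eq, heo_eq, hang]
  congr 1
  set u : ℝ := k₀ ^ 2 + frameLevel μ K (WithLp.toLp 2 c) ^ 2 with hu
  have hcπ : ∀ j, |c j| ≤ π := abs_torusCentredMomentum_le_pi L q.2
  have hsq : ∀ j, gnCutoff ((π + z) ^ 2 / π ^ 2) ((π + z) ^ 2) (c j ^ 2) = 1 := fun j =>
    sqCutoff_eq_one hz (by rw [← sq_abs]; exact pow_le_pow_left₀ (abs_nonneg _) (hcπ j) 2)
  rw [hZ c, hsq 0, hsq 1, one_mul, one_mul]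
  by_cases hR : (1 : ℝ) / 2 ≤ ‖momToComplex c‖
  · rw [radialCutoffC_eq_one (by norm_num) hR, one_mul, one_mul]
    ring
  · have hnot : ¬ (1 : ℝ) ≤ ‖momToComplex c‖ := fun h1 => hR (by linarith)
    have hbig : e₀ < |frameLevel μ K (WithLp.toLp 2 c)| := by
      by_contra hle
      exact hnot (one_le_norm_of_frameBand_le hA h3 (not_lt.1 hle))
    have h1 : gnScaleCutoff 4 e₀ (-(m : ℤ)) (Real.sqrt u) = 0 := gnScaleCutoff_eq_zero_of_band_gt he m hbig
    have h1' : bgmCutoffSq e₀ ((16 : ℝ) ^ m * u) = 0 := by rw [← gnScaleCutoff_sqrt_eq_bgmCutoffSq]; exact h1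
    rw [h1']; ring

omit [NeZero L] [NeZero M] in
/-- **The radial factors commute**: `F̃^{K_o}_{ω₁}(k)·F̃^{K}_{ω₂}(k) = F̃^{K}_{ω₁}(k)·F̃^{K_o}_{ω₂}(k)` (the angular factor does not see the frame).
[cite: BenfattoGiulianiMastropietro2006, §2.7 (2.66)] -/
theorem bgmFat_mul_bgmFat_comm_frames (k : FreqMomentum L M) :
    bgmFatMultiplier L M e₀ β (nambuXiCT L μ Ko) (m + 1) ω₁ k * bgmFatMultiplier L M e₀ β (nambuXiCT L μ K) (m + 1) ω₂ k =
      bgmFatMultiplier L M e₀ β (nambuXiCT L μ K) (m + 1) ω₁ k * bgmFatMultiplier L M e₀ β (nambuXiCT L μ Ko) (m + 1) ω₂ k := by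
  rw [bgmFat_apply (μ := μ) (e₀ := e₀) (β := β) (K := Ko) m ω₁, bgmFat_apply (μ := μ) (e₀ := e₀) (β := β) (K := K) m ω₂,
    bgmFat_apply (μ := μ) (e₀ := e₀) (β := β) (K := K) m ω₁, bgmFat_apply (μ := μ) (e₀ := e₀) (β := β) (K := Ko) m ω₂]
  push_cast
  ring

include hA h3 he hz hZ in
/-- **The fat INCREMENT pair IS the sample of the increment-pair symbol**: with `ν = e_K − e_{K_o}` (so `e_{K_o} = e_K − ν`),
`F̃^{K_o}_{ω₁}(k(q))·F̃^{K}_{ω₂}(k(q)) − F̃^{K}_{ω₁}(k(q))·F̃^{K}_{ω₂}(k(q)) = Φ^Δ(sample point)`,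
`Φ^Δ = (G_m(k₀² + (e_K − ν)²) − G_m(k₀² + e_K²))·(G_m(k₀² + e_K²)·Z_fat)` — the `hΦ`/`hGsΦ` shape of `norm_fwdDiff_iter_space_fatIncrPair_le`.
[cite: BenfattoGiulianiMastropietro2006, §2.7 (2.66)] -/
theorem bgmFatIncr_mul_bgmFat_eq_symbol {ν : (Fin 2 → ℝ) → ℝ} (hν : ∀ p, ν p = frameLevel μ K (WithLp.toLp 2 p) - frameLevel μ Ko (WithLp.toLp 2 p))
    {Φ : ℝ × (Fin 2 → ℝ) → ℂ}
    (hΦ : ∀ k₀ p, Φ (k₀, p) = (((bgmCutoffSq e₀ ((16 : ℝ) ^ m * (k₀ ^ 2 + (frameLevel μ K (WithLp.toLp 2 p) - ν p) ^ 2)) -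
      bgmCutoffSq e₀ ((16 : ℝ) ^ m * (k₀ ^ 2 + frameLevel μ K (WithLp.toLp 2 p) ^ 2))) *
      (bgmCutoffSq e₀ ((16 : ℝ) ^ m * (k₀ ^ 2 + frameLevel μ K (WithLp.toLp 2 p) ^ 2)) * Z p) : ℝ) : ℂ))
    (q : TorusSite 1 (2 * M) × TorusSite 2 L) :
    bgmFatMultiplier L M e₀ β (nambuXiCT L μ Ko) (m + 1) ω₁ (⟨(q.1 0).val, ZMod.val_lt (q.1 0)⟩, q.2) *
        bgmFatMultiplier L M e₀ β (nambuXiCT L μ K) (m + 1) ω₂ (⟨(q.1 0).val, ZMod.val_lt (q.1 0)⟩, q.2) -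
      bgmFatMultiplier L M e₀ β (nambuXiCT L μ K) (m + 1) ω₁ (⟨(q.1 0).val, ZMod.val_lt (q.1 0)⟩, q.2) *
        bgmFatMultiplier L M e₀ β (nambuXiCT L μ K) (m + 1) ω₂ (⟨(q.1 0).val, ZMod.val_lt (q.1 0)⟩, q.2) =
      Φ (π * (1 - 2 * M) / β + 2 * π / β * (((q.1 0).val : ℕ) : ℝ), fun j => 2 * π / L * (((q.2 j).valMinAbs : ℤ) : ℝ)) := by
  -- the two-frame symbol and the plain symbol
  obtain ⟨Φ₂, hΦ₂⟩ : ∃ Φ₂ : ℝ × (Fin 2 → ℝ) → ℂ, Φ₂ = fun x => ((bgmCutoffSq e₀ ((16 : ℝ) ^ m * (x.1 ^ 2 + frameLevel μ Ko (WithLp.toLp 2 x.2) ^ 2)) *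
      bgmCutoffSq e₀ ((16 : ℝ) ^ m * (x.1 ^ 2 + frameLevel μ K (WithLp.toLp 2 x.2) ^ 2)) * Z x.2 : ℝ) : ℂ) := ⟨_, rfl⟩
  obtain ⟨Φ₁, hΦ₁⟩ : ∃ Φ₁ : ℝ × (Fin 2 → ℝ) → ℂ, Φ₁ = fun x => ((bgmCutoffSq e₀ ((16 : ℝ) ^ m * (x.1 ^ 2 + frameLevel μ K (WithLp.toLp 2 x.2) ^ 2)) *
      bgmCutoffSq e₀ ((16 : ℝ) ^ m * (x.1 ^ 2 + frameLevel μ K (WithLp.toLp 2 x.2) ^ 2)) * Z x.2 : ℝ) : ℂ) := ⟨_, rfl⟩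
  have hΦ₂' : ∀ k₀ p, Φ₂ (k₀, p) = ((bgmCutoffSq e₀ ((16 : ℝ) ^ m * (k₀ ^ 2 + frameLevel μ Ko (WithLp.toLp 2 p) ^ 2)) *
      bgmCutoffSq e₀ ((16 : ℝ) ^ m * (k₀ ^ 2 + frameLevel μ K (WithLp.toLp 2 p) ^ 2)) * Z p : ℝ) : ℂ) := fun k₀ p => by rw [hΦ₂]
  have hΦ₁' : ∀ k₀ p, Φ₁ (k₀, p) = ((bgmCutoffSq e₀ ((16 : ℝ) ^ m * (k₀ ^ 2 + frameLevel μ K (WithLp.toLp 2 p) ^ 2)) *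
      bgmCutoffSq e₀ ((16 : ℝ) ^ m * (k₀ ^ 2 + frameLevel μ K (WithLp.toLp 2 p) ^ 2)) * Z p : ℝ) : ℂ) := fun k₀ p => by rw [hΦ₁]
  rw [bgmFat_mul_bgmFat_eq_symbol₂ Ko hA he hz h3 m ω₁ ω₂ hZ hΦ₂' q, bgmFat_mul_bgmFat_eq_symbol hA he hz h3 m ω₁ ω₂ hZ hΦ₁' q,
    hΦ₂', hΦ₁', hΦ]
  have hsub : ∀ p : Fin 2 → ℝ, frameLevel μ K (WithLp.toLp 2 p) - ν p = frameLevel μ Ko (WithLp.toLp 2 p) := fun p => by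
    rw [hν p]; ring
  rw [hsub]
  push_cast
  ring

end IncrIdent

end Summit.HubbardSuperconductivity.HubbardSuperconductivity.Theorems.TorusFourierL2

end
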